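import Literature.NumberTheory.EllipticCurves.TianYuanZhang2017.CMPointClassFieldProofs
import Literature.NumberTheory.EllipticCurves.TianYuanZhang2017.UPlusOfGenusPointData
import HarnessLib

/-!
# Route B's displayed hypothesis `tyz_cmPointClassFieldData` REDUCED: three displayed conjuncts are kernel theorems
# of the others — Tian–Yuan–Zhang's Theorem 3.5 second bullet, «`σ_{1+ϖ}` fixes `√−d`», and «`σ ∈ Gal(H′_d/H_d)`»
# for `d ≡ 6 (mod 8)` — and the named fact `tyz_cmPointClassFieldDataReduced` ⟺ `tyz_cmPointClassFieldData`

A DERIVABILITY AUDIT of the route-B corner's displayed hypothesis (cell `bsd-monsky`, typer seat; the corner of record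
`P2.congruentSilentEvenFiveBSDTwo_of_cmPointClassFieldData_descent (hCF)` takes `hCF = tyz_cmPointClassFieldData` —
`GenusPointData.Printed ∧ GenusPointData.CMPointClassFieldPrinted` for every square-free `n ≡ 5, 6, 7 (mod 8)` — and nothing
else).  Three of its displayed conjuncts are KERNEL CONSEQUENCES of the remaining ones; this file proves them, displays the
hypothesis with those three struck, and proves the two named facts EQUIVALENT.  Nothing is asserted (no `_holds`; the CM
points, class fields and the Artin map are not constructed in the tree); no count moves.

## The three struck conjuncts and their derivations

1. **Theorem 3.5, second bullet** (`GenusPointData.thm35Bullet2`; [TianYuanZhang2017] J741 = arXiv chunk p0011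
   L100–L112: «Assume that `P(n) ∈ A(K_n)⁻ + A[4]` … If `n ≡ 5, 7 (mod 8)`, then `Σ … ≡ Σ … ≡ 0 (mod 2)`. If `n ≡ 6 (mod 8)`,
   then `Σ … ≡ 0 (mod 2)`») is a kernel theorem of `prop34` (Prop. 3.4), `lemma318` (Lemma 3.18), `betaSpec` (the Galois
   facts on `β′`) and `lemma321` (Lemma 3.21) — by the source's OWN printed proof (p0020 L106–L165, p0021 L1–L5): write
   `P(n) = P + t` with `P ∈ A(K_n)⁻`, `t ∈ A[4]`; «`β` acts on `K_n` by `√−n ↦ −√−n`. It follows that `P(n)^β + P(n) =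
   t^β + t`» (`normA_map_embK_eq_zero`: `(β+1)P = 0` from `betaSpec`'s first conjunct); for `n ≡ 5, 7`, «`t ∈ A(ℍ′_n)[4] =
   A(ℚ(i))` by Lemma 3.18. Note that `β` acts on `ℚ(i)` trivially. Then `P(n)^β + P(n) = 2t ∈ ℤτ(1)`» (`W2.stub_K4'`);
   for `n ≡ 6`, «`P(n)^β + P(n) ∈ (β+1)A[4] = A[2]`» (`betaSpec`'s third conjunct); «Apply `β′+1` to both sides of
   Proposition 3.4. By Lemma 3.21 …» (`W2.stub_K5'`, the bracket relation with `(β′+1)P(n)` still present); «the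
   contribution from `2A(ℍ′_n)^{β′+1}` is torsion … the left-hand side lies in `ℤτ(1)`. Thus the coefficients in both of
   the brackets must be even» / «lies in `A[2]`. It follows that the first two coefficients have the same parity»
   (`W2.Abstract.even_brackets_odd_of_normA_mem`, `W2.Abstract.even_iff_even_six_of_two_nsmul_normA` — the abstract
   parity steps of `GenusDescentAbstract.lean` with the hypothesis on `(β′+1)P(n)` taken DIRECTLY, instead of through the
   `E`-side `ρ`-free relation of W2); brackets = genus sums (`W2.genusSum₂'_eq_brackets`, `W2.genusSum₁_eq_bFivePlain`,
   `W2.genusSum₁_eq_bSeven`).  `thm35Bullet2_of_core`; `PrintedCore` = `Printed` with this conjunct struck;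
   `printed_iff_printedCore`.  (The printed «i.e. `2^{−ρ(n)}𝓛(n)` is even», `thm35Bullet2Ie`, STAYS displayed: its
   derivation in print needs the rank-one presupposition of Thm. 3.5's main clause, which the display carries only as a
   hypothesis on `α_n` — no generator, no derivation; referee ruling (β) of `GenusPointDescentDisplays.lean`.)
2. **«`σ_{1+ϖ}` fixes `√−d`»** (the first conjunct of `GenusPointData.ThetaBlockSpec`, `d ≡ 6 (mod 8)`: the lift `θ` of
   `σ_{1+ϖ} ∈ Gal(K_d^{ab}/K_d)` fixes `√−d`) is a kernel theorem of the third conjunct «`σ_{1+ϖ}` generates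
   `Gal(H′_d/H_d)`» (Prop. 3.2 (2), J738 = p0010 L111: `θ ∈ Gal(ℍ′_n/H_d)`), (G4b) «the genus field `L_d` is the subfield of
   `H_d` fixed by `2Cl_d`» (`Gal(ℍ′_n/H_d) ≤ Gal(ℍ′_n/L_d)`, J759 L25) and Cox's Theorem 6.1 (ii) with the naming sentence
   `genusFieldIs` (an automorphism fixing the genus field of `K_d` fixes `√−d`): `ThetaBlockSpecReduced` (three conjuncts),
   `thetaBlockSpec_of_reduced`.
3. **«`σ ∈ Gal(H′_d/H_d)`» for `d ≡ 6 (mod 8)`** (the first conjunct of (G6), «Let `σ` be the unique order-two element of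
   `Gal(H′_n/H_n)`», J738 = p0011 L3) is, for `d ≡ 6`, a kernel theorem of (G8) «`σ_{1+ϖ}` generates `Gal(H′_d/H_d)`»
   and «`σ = σ²_{1+ϖ}` on `H′_d`» (`θ ∈ ΓH`, `θ²σ⁻¹ ∈ ΓH'`) with (G4a) `ΓH' ≤ ΓH`: `σ = (θ²σ⁻¹)⁻¹ θ²`.  For `d ≡ 5 (mod 8)`
   there is no `σ_{1+ϖ}` and the sentence stays displayed: `CMBlockClassFieldSpecReduced` displays (G6)'s first conjunct as
   `d % 8 = 5 → σ ∈ ΓH` (the other conjuncts of `CMBlockClassFieldSpec` VERBATIM, in the same order);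
   `cmBlockClassFieldSpec_of_reduced`.

## What is NOT derivable (the census, conjunct by conjunct, at this desk's level of reading; no minimality claimed)

`Printed`: `scriptLSpec` (the only sentence on `IsScriptL`), `epsSpec` (on `eps`), `recursion` (on `P(d)`, `d ≠ n`),
`prop34` (its printed proof uses the parities of `𝓛(d₁)`, Thm. 1.1 — not displayed), `thm35Main` (on `P(n)` against `𝓛(n)`),
`thm35Bullet1` (`φ(2P(n)) ∈ E(K_n)⁻`: the Galois action of `Gal(ℍ′_n/K_n)` on `P(n)` is displayed only on the subgroup
trivial on `L_d(i)`, (G7)), `thm35Bullet2Ie` (above), `lemma318` (the only sentences on the torsion of `A(ℍ′_n)`; for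
`n` even the half «`#A(ℍ′_n)[4] = 16`» would follow from `i, √−2 ∈ ℍ′_n` by the sixteen explicit points of `A[4]` over
`ℚ(ζ₈)` — a kernel computation not done here), `betaSpec` (the only sentences on `β`), `lemma321` (on `(β+1)Z(d)`).
`CMPointClassFieldPrinted`: `ConjSpec` (the only sentences on `c`'s values and order); `genusFieldIs`, `coxThm61ii`,
`coxThm918` (universal sentences on the abstract predicates); per block (G1) (the only sentence tying `Z(d)` to `z_d`, and
`#Φ₀` to `g(d)` — no displayed sentence links the Galois groups to the class group), (G2), (G3) (the only sentences making
`ΓH'` fix `z_d` / `H′_d/K_d` Abelian), (G4a) (the only sentence `ΓH' ≤ ΓH`), (G5) (on `c·z_d`), (G6)'s «`σ² = 1` on `H′_d`»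
(from (G8) one gets `σ² ≡ θ⁴`, and «`Gal(H′_d/H_d) ≃ ℤ/4ℤ`» is not displayed) and «`z_d^σ = z_d + τ(1)`» (without it
`θ(i) = i`, `z^σ = z` is consistent with the rest), (G7) (the only sentences on representatives), (R) (the only sentence on
`InRingClassField`); (G8)'s «`z^{σ_{1+ϖ}} = z + τ((1−i)/2)`», «`θ ∈ ΓH`», «`θ² ≡ σ`» (each the only sentence on its datum);
(G9) (the only sentence on `Z(d)`, `d ≡ 7`).

## Consumption on `𝒮⁻` (information, not minimality): at `n = 2pq` the route-B chain reads `scriptLSpec`, `epsSpec`,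
## `recursion`, `thm35Main`, `lemma318` of `Printed` and, of the blocks, `2pq` (G1)(G2)(G3)(G4b)(G6 third)(G8), `p`
## (G1)–(G7), `pq` resp. `q` (G9); the block `2q` and the remaining conjuncts are idle there (`P2/…ThetaCMGalois.lean`).

HONEST FRAMING: `tyz_cmPointClassFieldDataReduced` is a named fact with NO `_holds`; consumers take it as a hypothesis; it
is EQUIVALENT in the kernel to `tyz_cmPointClassFieldData` (`tyz_cmPointClassFieldData_iff_reduced`), so every consumer of
the latter runs unchanged through `tyz_cmPointClassFieldData_of_reduced`.  Origin: cell `bsd-monsky`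
(run/shared/lean/pub/bsd-monsky/), typer seat g17; locators J = journal page of AJM 21 (2017), p00NN Lmm = arXiv chunk of
`paper:arxiv-1411.4728`; Cox locators = theorem numbers.

References: [TianYuanZhang2017] Prop. 3.2 (1)(2) (J738 = p0010 L108–L111), §3.1 (J738 = p0011 L3), Thm. 3.5 (J741 = p0011
L94–L112) and its proof (p0020 L106–L165, p0021 L1–L5), Lemma 3.18 (p0017 L152–L153), Lemma 3.21 (p0020 L27–L45), proof of
Lemma 3.21 (J759 L25); [Cox2013] Theorem 6.1 (ii).
-/

noncomputable section

open scoped Classical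

open WeierstrassCurve WeierstrassCurve.Affine Finset

namespace Literature.NumberTheory.EllipticCurves.TianYuanZhang2017

/-! ## §1 The two abstract parity steps of the proof of Thm. 3.5 (2) with the hypothesis on `(β′+1)P(n)` taken directly -/

namespace W2.Abstract

variable {GA : Type*} [AddCommGroup GA]

/-- **Thm. 3.5 (2), classes `5` and `7`, abstract form, from `(β′+1)P(n) ∈ ℤτ(1)`** (p0020 L122, L136–L141: «the left-hand
side lies in `ℤτ(1)`. Thus the coefficients in both of the brackets must be even»): the torsion rules of Lemma 3.18 +
`β′|ℚ(i) = id` («`N_A t = 2t`, `2t ∈ ℤτ(1)` for torsion `t`»), the `τ`-table facts, the bracket relation with `N_A P`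
still present, and `N_A P ∈ ℤτ(1)` give both brackets even. The second half of `even_brackets_odd`, with the `E`-side
relation replaced by its consequence. [cite: TianYuanZhang2017, proof of Thm. 3.5 (2) (chunk p0020 L107–L141)] -/
theorem even_brackets_odd_of_normA_mem (NA : GA →+ GA) {τ1 τa τb : GA} (h2 : (2 : ℕ) • τ1 = 0) (hτ1 : τ1 ≠ 0)
    (hτa : (2 : ℕ) • τa = 0) (hτa' : τa ∉ AddSubgroup.zmultiples τ1) (hτb : (2 : ℕ) • τb = τ1)
    (htor : ∀ t : GA, IsOfFinAddOrder t →
      NA t = (2 : ℕ) • t ∧ (2 : ℕ) • t ∈ AddSubgroup.zmultiples τ1)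
    {P : GA} (hNPmem : NA P ∈ AddSubgroup.zmultiples τ1) {B₅ B₇ : ℕ}
    (hF4 : ∃ (a : GA) (k : ℤ), (B₅ : ℤ) • τa + (B₇ : ℤ) • τb - NA P = NA ((2 : ℕ) • a) + k • τ1) :
    Even B₅ ∧ Even B₇ := by
  obtain ⟨a, k, ha⟩ := hF4
  have hτ1fin : IsOfFinAddOrder τ1 := isOfFinAddOrder_iff_nsmul_eq_zero.mpr ⟨2, by norm_num, h2⟩
  have hlhs : IsOfFinAddOrder ((B₅ : ℤ) • τa + (B₇ : ℤ) • τb - NA P) := by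
    rw [sub_eq_add_neg]
    refine IsOfFinAddOrder.add (IsOfFinAddOrder.add ?_ ?_) (isOfFinAddOrder_of_mem_zmultiples h2 hNPmem).neg
    · exact (isOfFinAddOrder_iff_nsmul_eq_zero.mpr ⟨2, by norm_num, hτa⟩).zsmul
    · exact (isOfFinAddOrder_of_two_nsmul (hτb ▸ hτ1fin)).zsmul
  have hNa : IsOfFinAddOrder (NA a) := by
    have e : NA ((2 : ℕ) • a) = ((B₅ : ℤ) • τa + (B₇ : ℤ) • τb - NA P) + -(k • τ1) := by
      rw [ha]; abel
    have : IsOfFinAddOrder (NA ((2 : ℕ) • a)) := by rw [e]; exact hlhs.add hτ1fin.zsmul.neg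
    rw [map_nsmul] at this
    exact isOfFinAddOrder_of_two_nsmul this
  have h2Na : NA ((2 : ℕ) • a) ∈ AddSubgroup.zmultiples τ1 := by
    rw [map_nsmul]; exact (htor _ hNa).2
  have hsum : (B₅ : ℤ) • τa + (B₇ : ℤ) • τb ∈ AddSubgroup.zmultiples τ1 := by
    have e : (B₅ : ℤ) • τa + (B₇ : ℤ) • τb = NA ((2 : ℕ) • a) + k • τ1 + NA P := by
      rw [← ha, sub_add_cancel]
    rw [e]
    exact AddSubgroup.add_mem _ (AddSubgroup.add_mem _ h2Na
      (AddSubgroup.zsmul_mem _ (AddSubgroup.mem_zmultiples τ1) k)) hNPmem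
  obtain ⟨h5, h7⟩ := even_and_even_of_mem_zmultiples h2 hτ1 hτa hτa' hτb hsum
  exact ⟨(Int.even_coe_nat B₅).mp h5, (Int.even_coe_nat B₇).mp h7⟩

/-- **Thm. 3.5 (2), class `6`, abstract form, from `2·(β′+1)P(n) = 0`** (p0020 L146, p0021 L1–L3: «`P(n)^β + P(n) ∈
(β+1)A[4] = A[2]` … the left-hand side lies in `A[2]`. It follows that the first two coefficients have the same parity»):
the torsion rules «`4t = 0`, `2·N_A t = 0`», the `τ`-table facts, the three-term bracket relation with `N_A P` still
present, and `2·N_A P = 0` give the first two brackets the same parity. The second half of `even_iff_even_six`.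
[cite: TianYuanZhang2017, proof of Thm. 3.5 (2) (chunk p0020 L143–L165, p0021 L1–L3)] -/
theorem even_iff_even_six_of_two_nsmul_normA (NA : GA →+ GA) {τ1 τb τc τd : GA} (h2 : (2 : ℕ) • τ1 = 0)
    (hτ1 : τ1 ≠ 0) (hτb : (2 : ℕ) • τb = τ1) (hτc : (2 : ℕ) • τc = τ1) (hτd : (2 : ℕ) • τd = 0)
    (htor : ∀ t : GA, IsOfFinAddOrder t → (4 : ℕ) • t = 0 ∧ (2 : ℕ) • NA t = 0)
    {P : GA} (h2NP : (2 : ℕ) • NA P = 0) {B₆ B₇₂ B₅₃₂ : ℕ}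
    (hF4 : ∃ (a : GA) (k : ℤ),
      (B₆ : ℤ) • τc + (B₇₂ : ℤ) • τb + (B₅₃₂ : ℤ) • τd - NA P = NA ((2 : ℕ) • a) + k • τ1) :
    (Even B₆ ↔ Even B₇₂) := by
  have hNPfin : IsOfFinAddOrder (NA P) := isOfFinAddOrder_iff_nsmul_eq_zero.mpr ⟨2, by norm_num, h2NP⟩
  obtain ⟨a, k, ha⟩ := hF4
  have hτ1fin : IsOfFinAddOrder τ1 := isOfFinAddOrder_iff_nsmul_eq_zero.mpr ⟨2, by norm_num, h2⟩
  have hlhs : IsOfFinAddOrder ((B₆ : ℤ) • τc + (B₇₂ : ℤ) • τb + (B₅₃₂ : ℤ) • τd - NA P) := by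
    rw [sub_eq_add_neg]
    refine IsOfFinAddOrder.add (IsOfFinAddOrder.add (IsOfFinAddOrder.add ?_ ?_) ?_) hNPfin.neg
    · exact (isOfFinAddOrder_of_two_nsmul (hτc ▸ hτ1fin)).zsmul
    · exact (isOfFinAddOrder_of_two_nsmul (hτb ▸ hτ1fin)).zsmul
    · exact (isOfFinAddOrder_iff_nsmul_eq_zero.mpr ⟨2, by norm_num, hτd⟩).zsmul
  have hNa : IsOfFinAddOrder (NA a) := by
    have e : NA ((2 : ℕ) • a) =
        ((B₆ : ℤ) • τc + (B₇₂ : ℤ) • τb + (B₅₃₂ : ℤ) • τd - NA P) + -(k • τ1) := by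
      rw [ha]; abel
    have : IsOfFinAddOrder (NA ((2 : ℕ) • a)) := by rw [e]; exact hlhs.add hτ1fin.zsmul.neg
    rw [map_nsmul] at this
    exact isOfFinAddOrder_of_two_nsmul this
  have h2rhs : (2 : ℕ) • NA ((2 : ℕ) • a) = 0 := by
    rw [map_nsmul, smul_smul]
    exact (htor _ hNa).1
  have hsum : (2 : ℕ) • ((B₆ : ℤ) • τc + (B₇₂ : ℤ) • τb + (B₅₃₂ : ℤ) • τd) = 0 := by
    have e : (B₆ : ℤ) • τc + (B₇₂ : ℤ) • τb + (B₅₃₂ : ℤ) • τd = NA ((2 : ℕ) • a) + k • τ1 + NA P := by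
      rw [← ha, sub_add_cancel]
    rw [e, smul_add, smul_add, h2rhs, h2NP, add_zero, zero_add, smul_comm, h2, smul_zero]
  have key := even_iff_even_of_two_nsmul_eq_zero h2 hτ1 hτb hτc hτd hsum
  rw [Int.even_coe_nat, Int.even_coe_nat] at key
  exact key

end W2.Abstract

namespace GenusPointData

variable {n : ℕ}

/-! ## §2 Theorem 3.5's second bullet is a kernel theorem of Prop. 3.4, Lemma 3.18, the `β′`-facts and Lemma 3.21 -/

/-- **«`β` acts on `K_n` by `√−n ↦ −√−n`. It follows that `P(n)^β + P(n) = t^β + t`»** (p0020 L118): `(β′+1)` kills the image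
of `A(K_n)⁻` in `A(ℍ′_n)` — for `α ∈ A(K_n)⁻` (`ᾱ = −α`), `N_A(ι α) = ι(ᾱ) + ι(α) = 0` (`betaSpec`'s first conjunct through
`W2.beta_comp_embK`). [cite: TianYuanZhang2017, proof of Thm. 3.5 (2) (chunk p0020 L118)] -/
theorem normA_map_embK_eq_zero (D : GenusPointData n) (hn : n ∈ n.divisors) (hβ : D.betaSpec)
    {α : APoint (GenusField n)} (hα : α ∈ minusPart n) :
    W2.normA D (Point.map (W' := curveA) (D.embK n hn) α) = 0 := by
  have hα' : Point.map (W' := curveA) (genusFieldConj n) α = -α := hα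
  have key : Point.map (W' := curveA) D.beta.toAlgHom (Point.map (W' := curveA) (D.embK n hn) α) =
      -Point.map (W' := curveA) (D.embK n hn) α := by
    rw [Point.map_map, W2.beta_comp_embK D hn hβ, ← Point.map_map, hα', map_neg]
  simp only [W2.normA, AddMonoidHom.add_apply, AddMonoidHom.id_apply, key, neg_add_cancel]

/-- **Theorem 3.5, second bullet, AS PRINTED, is a kernel theorem of Prop. 3.4, Lemma 3.18, the `β′`-facts and Lemma 3.21**
— the source's own proof (p0020 L106–L165, p0021 L1–L5) run in the kernel: `P(n) = P + t` ⟹ `(β′+1)P(n) = (β′+1)t`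
(`normA_map_embK_eq_zero`); `n ≡ 5, 7`: `(β′+1)t = 2t ∈ ℤτ(1)` (Lemma 3.18, `β|ℚ(i) = id`: `W2.stub_K4'`); `n ≡ 6`:
`2(β′+1)t = 0` (`(β+1)A[4] = A[2]`); `β′+1` applied to Prop. 3.4 with Lemma 3.21 (`W2.stub_K5'`); the parity steps
`W2.Abstract.even_brackets_odd_of_normA_mem` / `…even_iff_even_six_of_two_nsmul_normA`; brackets = genus sums.
[cite: TianYuanZhang2017, Thm. 3.5 second bullet (chunk p0011 L100–L112) and its proof (p0020 L106–L165, p0021 L1–L5)] -/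
theorem thm35Bullet2_of_core (D : GenusPointData n) (hsq : Squarefree n)
    (h8 : n % 8 = 5 ∨ n % 8 = 6 ∨ n % 8 = 7) (h34 : D.prop34) (h318 : D.lemma318) (hβ : D.betaSpec)
    (h321 : D.lemma321) : D.thm35Bullet2 := by
  intro hn hP
  obtain ⟨α, hα, t, ht4, hPt⟩ := hP
  have hNP : W2.normA D (D.P n) = W2.normA D t := by
    rw [hPt, map_add, D.normA_map_embK_eq_zero hn hβ hα, zero_add]
  have htfin : IsOfFinAddOrder t := isOfFinAddOrder_iff_nsmul_eq_zero.mpr ⟨4, by norm_num, ht4⟩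
  obtain ⟨hτ1, hτhalf, hτihalf, hτa0, hτa', hτia0, hτia'⟩ := W2.tau_facts D
  have hτ1ne : (tauOne : APoint D.H) ≠ 0 := tauOne_ne_zero
  refine ⟨fun h57 => ?_, fun h6 => ?_⟩
  · -- classes 5 and 7: `(β′+1)P(n) = 2t ∈ ℤτ(1)`
    have hodd : Odd n := by rcases h57 with h | h <;> exact Nat.odd_iff.mpr (by omega)
    have htor : ∀ u : APoint D.H, IsOfFinAddOrder u →
        W2.normA D u = (2 : ℕ) • u ∧ (2 : ℕ) • u ∈ AddSubgroup.zmultiples (tauOne : APoint D.H) := by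
      intro u hu
      refine ⟨by rw [W2.normA_apply, W2.stub_K4' D h318 hβ hodd u hu, two_nsmul], ?_⟩
      rcases (h318.1 hodd u hu).2 with h0 | h0
      · rw [h0]; exact zero_mem _
      · rw [h0]; exact AddSubgroup.mem_zmultiples _
    have hNPmem : W2.normA D (D.P n) ∈ AddSubgroup.zmultiples (tauOne : APoint D.H) := by
      rw [hNP, (htor t htfin).1]; exact (htor t htfin).2
    set τa : APoint D.H := if n % 8 = 5 then D.tauHalfOneMinusI else D.iPt D.tauHalfOneMinusI with hτa
    have hτa2 : (2 : ℕ) • τa = 0 := by rw [hτa]; split_ifs <;> assumption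
    have hτanot : τa ∉ AddSubgroup.zmultiples (tauOne : APoint D.H) := by
      rw [hτa]; split_ifs <;> assumption
    obtain ⟨a, k, hrel⟩ := W2.stub_K5' D hsq h8 h34 h321 hβ
    rw [W2.bSix_eq_zero_of_odd hodd, W2.cI_eq_zero_of_odd hodd, Nat.cast_zero, zero_smul, zero_smul,
      add_zero, add_zero] at hrel
    rw [W2.genusSum₂'_eq_brackets, W2.bSix_eq_zero_of_odd hodd, add_zero]
    rcases h57 with h5' | h7'
    · rw [W2.bFiveI_eq_zero_of_five h5', Nat.cast_zero, zero_smul, add_zero] at hrel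
      rw [hτa, if_pos h5'] at hτa2 hτanot
      obtain ⟨h5, h7⟩ := W2.Abstract.even_brackets_odd_of_normA_mem (W2.normA D) hτ1 hτ1ne hτa2 hτanot
        hτhalf htor hNPmem ⟨a, k, hrel⟩
      rw [W2.genusSum₁_eq_bFivePlain h5', W2.bFiveI_eq_zero_of_five h5', add_zero]
      exact ⟨h5, h5.add h7⟩
    · rw [W2.bFivePlain_eq_zero_of_seven h7', Nat.cast_zero, zero_smul, zero_add] at hrel
      rw [hτa, if_neg (show ¬ n % 8 = 5 by omega)] at hτa2 hτanot
      obtain ⟨h5, h7⟩ := W2.Abstract.even_brackets_odd_of_normA_mem (W2.normA D) hτ1 hτ1ne hτa2 hτanot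
        hτhalf htor hNPmem ⟨a, k, hrel⟩
      rw [W2.genusSum₁_eq_bSeven h7', W2.bFivePlain_eq_zero_of_seven h7', zero_add]
      exact ⟨h7, h5.add h7⟩
  · -- class 6: `2·(β′+1)P(n) = 2·(β′+1)t = 0`
    have heven : Even n := Nat.even_iff.mpr (by omega)
    have htor : ∀ u : APoint D.H, IsOfFinAddOrder u → (4 : ℕ) • u = 0 ∧ (2 : ℕ) • W2.normA D u = 0 := by
      intro u hu
      have h4 := (h318.2 heven).1 u hu
      exact ⟨h4, by rw [W2.normA_apply]; exact (hβ.2.2 heven).1 u h4⟩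
    have h2NP : (2 : ℕ) • W2.normA D (D.P n) = 0 := by rw [hNP]; exact (htor t htfin).2
    obtain ⟨a, k, hrel⟩ := W2.stub_K5' D hsq h8 h34 h321 hβ
    rw [W2.bFivePlain_eq_zero_of_six h6, W2.bFiveI_eq_zero_of_six h6, Nat.cast_zero, zero_smul, zero_smul,
      zero_add, zero_add] at hrel
    have key := W2.Abstract.even_iff_even_six_of_two_nsmul_normA (W2.normA D) hτ1 hτ1ne hτhalf hτihalf hτia0
      htor h2NP ⟨a, k, hrel⟩
    rw [W2.genusSum₂'_eq_brackets, W2.bFivePlain_eq_zero_of_six h6, W2.bFiveI_eq_zero_of_six h6, zero_add,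
      zero_add]
    exact Nat.even_add.mpr key

/-- **`Printed` with Theorem 3.5's second bullet struck** (the ten other conjuncts VERBATIM, in the same order): Prop. 3.4,
Thm. 3.5's main clause, first bullet and «i.e.», Lemma 3.18, the `β′`-facts, Lemma 3.21, and the sign / `ε` / recursion
sentences. A predicate; nothing asserted. [cite: TianYuanZhang2017, §3 (Prop. 3.4, Thm. 3.5, Lemma 3.18, Lemma 3.21, proof of Thm. 3.5 (2))] -/
def PrintedCore (D : GenusPointData n) : Prop :=
  D.scriptLSpec ∧ D.epsSpec ∧ D.recursion ∧ D.prop34 ∧ D.thm35Main ∧ D.thm35Bullet1 ∧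
    D.thm35Bullet2Ie ∧ D.lemma318 ∧ D.betaSpec ∧ D.lemma321

/-- `Printed ⟹ PrintedCore` (drop the conjunct). [cite: TianYuanZhang2017, §3] -/
theorem printedCore_of_printed (D : GenusPointData n) (h : D.Printed) : D.PrintedCore := by
  obtain ⟨h1, h2, h3, h4, h5, h6, -, h7, h8, h9, h10⟩ := h
  exact ⟨h1, h2, h3, h4, h5, h6, h7, h8, h9, h10⟩

/-- `PrintedCore ⟹ Printed` for square-free `n ≡ 5, 6, 7 (mod 8)` (the struck bullet is a kernel theorem of the rest).
[cite: TianYuanZhang2017, Thm. 3.5 second bullet and its proof (p0020 L106–L165, p0021 L1–L5)] -/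
theorem printed_of_printedCore (D : GenusPointData n) (hsq : Squarefree n)
    (h8 : n % 8 = 5 ∨ n % 8 = 6 ∨ n % 8 = 7) (h : D.PrintedCore) : D.Printed := by
  obtain ⟨h1, h2, h3, h4, h5, h6, h7, h318, h9, h10⟩ := h
  exact ⟨h1, h2, h3, h4, h5, h6, D.thm35Bullet2_of_core hsq h8 h4 h318 h9 h10, h7, h318, h9, h10⟩

/-- **`Printed ⟺ PrintedCore`** for square-free `n ≡ 5, 6, 7 (mod 8)`.
[cite: TianYuanZhang2017, Thm. 3.5 second bullet and its proof (p0020 L106–L165, p0021 L1–L5)] -/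
theorem printed_iff_printedCore (D : GenusPointData n) (hsq : Squarefree n)
    (h8 : n % 8 = 5 ∨ n % 8 = 6 ∨ n % 8 = 7) : D.Printed ↔ D.PrintedCore :=
  ⟨D.printedCore_of_printed, D.printed_of_printedCore hsq h8⟩

/-! ## §3 The block layer with «`σ_{1+ϖ}` fixes `√−d`» and «`σ ∈ Gal(H′_d/H_d)` for `d ≡ 6`» struck -/

/-- **(G8) with its first conjunct struck**: Thm. 3.6 (2) «`z_n^{σ_{1+ϖ}} = z_n + τ((1−i)/2)`» (modulo `ℤτ(1)`), Prop. 3.2 (2)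
«`Gal(H′_n/H_n) ≃ ℤ/4ℤ` is generated by `σ_{1+ϖ}`» (`θ ∈ Gal(ℍ′_n/H_d)`) and «`σ = σ²_{1+ϖ}` on `H′_d`» (`θ²σ⁻¹ ∈
Gal(ℍ′_n/H′_d)`) — VERBATIM the last three conjuncts of `ThetaBlockSpec`; the struck «`θ` fixes `√−d`» is a kernel theorem
of `θ ∈ Gal(ℍ′_n/H_d)`, (G4b) and Cox's Theorem 6.1 (ii) (`thetaBlockSpec_of_reduced`). A predicate; nothing asserted.
[cite: TianYuanZhang2017, Prop. 3.2 (2) (J738 = p0010 L111) and Thm. 3.6 (2) (J741 = p0012 L31–L33)] -/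
def ThetaBlockSpecReduced (D : GenusPointData n) (z : APoint D.H) (ΓH ΓH' : Subgroup (D.H ≃ₐ[ℚ] D.H))
    (σ θ : D.H ≃ₐ[ℚ] D.H) : Prop :=
  (∃ m₀ : ℤ, D.galPt θ z = z + D.tauHalfOneMinusI + m₀ • tauOne) ∧ θ ∈ ΓH ∧ θ * θ * σ⁻¹ ∈ ΓH'

/-- `ThetaBlockSpec ⟹ ThetaBlockSpecReduced` (drop the conjunct). [cite: TianYuanZhang2017, Prop. 3.2 (2), Thm. 3.6 (2)] -/
theorem thetaBlockSpecReduced_of_spec (D : GenusPointData n) {d : ℕ} {z : APoint D.H}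
    {ΓH ΓH' : Subgroup (D.H ≃ₐ[ℚ] D.H)} {σ θ : D.H ≃ₐ[ℚ] D.H} (h : D.ThetaBlockSpec d z ΓH ΓH' σ θ) :
    D.ThetaBlockSpecReduced z ΓH ΓH' σ θ := by
  obtain ⟨-, h36, hθH, hθθσ⟩ := h
  exact ⟨h36, hθH, hθθσ⟩

namespace ClassFieldData

/-- **«`σ_{1+ϖ}` fixes `√−d`» is a kernel theorem**: `θ ∈ Gal(ℍ′_n/H_d)` (Prop. 3.2 (2)), `Gal(ℍ′_n/H_d) ≤ Gal(ℍ′_n/L_d)`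
((G4b), J759 L25) and Cox's Theorem 6.1 (ii) on the genus field `L_d` of `K_d` (`genusFieldIs`, `coxThm61ii`: an
automorphism fixing `L_d` fixes `√−d`) give `θ(√−d) = √−d`. [cite: TianYuanZhang2017, Prop. 3.2 (2) (J738 = p0010 L111), proof of Lemma 3.21 (J759 L25)]
[cite: Cox2013, Theorem 6.1 (ii)] -/
theorem thetaBlockSpec_of_reduced {D : GenusPointData n} (C : D.ClassFieldData) {d : ℕ} (hd : d ∈ n.divisors)
    (hGF : C.genusFieldIs) (h61 : C.coxThm61ii) {z : APoint D.H} {ΓH ΓH' : Subgroup (D.H ≃ₐ[ℚ] D.H)}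
    {σ θ : D.H ≃ₐ[ℚ] D.H} (hG4b : ∀ γ ∈ ΓH, γ ∈ C.ΓL d) (h : D.ThetaBlockSpecReduced z ΓH ΓH' σ θ) :
    D.ThetaBlockSpec d z ΓH ΓH' σ θ := by
  obtain ⟨h36, hθH, hθθσ⟩ := h
  exact ⟨((h61 d hd (C.ΓL d) (hGF d hd) θ).mp (hG4b θ hθH)).1, h36, hθH, hθθσ⟩

/-- **`CMBlockClassFieldSpec` with «`σ ∈ Gal(H′_d/H_d)`» displayed for `d ≡ 5 (mod 8)` only** — (G1)–(G5), (G6)'s «`σ² = 1`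
on `H′_d`» and «`z_d^σ = z_d + τ(1)`», (G7), (R) VERBATIM in the same order; (G6)'s first conjunct «Let `σ` be the unique
order-two element of `Gal(H′_n/H_n)`» (J738 = p0011 L3) is displayed as `d % 8 = 5 → σ ∈ Gal(ℍ′_n/H_d)`: for `d ≡ 6` it is
a kernel theorem of (G8) and (G4a) (`cmBlockClassFieldSpec_of_reduced`). A predicate; nothing asserted.
[cite: TianYuanZhang2017, §3.1 (J738–J739 = p0010 L104–L115, p0011 L1–L13, L53–L58), Prop. 3.2 (1)(2) (J738), Thm. 3.6 (1)(2) (J741 = p0012 L22–L36), proof of Lemma 3.21 (J759 = p0020 L50–L63)] -/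
def CMBlockClassFieldSpecReduced {D : GenusPointData n} (C : D.ClassFieldData) (d : ℕ) (z : APoint D.H)
    (Φ : Finset (D.H ≃ₐ[ℚ] D.H)) (ΓH ΓH' : Subgroup (D.H ≃ₐ[ℚ] D.H)) (σ c : D.H ≃ₐ[ℚ] D.H) : Prop :=
  -- (G1) "Z(n) := Σ_{t∈Φ₀} f_n(P_n)^t", "Φ₀ = {t_i : i = 1, ⋯, g(n)}"
  (D.Z d = ∑ t ∈ Φ, D.galPt t z ∧ Φ.card = gK d) ∧
  -- (G2) "Φ₀ = Φ ∩ (2Cl′_n)", "the subfield of H′_n fixed by 2Cl′_n is L_n [n ≡ 5], L_n(i) [n ≡ 6]", "L_n(i) = ℚ(i, √d : d | n)"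
  ((d % 8 = 5 → ∀ t ∈ Φ, t ∈ C.ΓL d) ∧ (d % 8 = 6 → ∀ t ∈ Φ, D.TrivialOnL d t)) ∧
  -- (G3) Gal(ℍ′_n/H′_d): "z_n ∈ A(K_n^ab) … H′_n = H_n(z_n)" — fixes z_d; H′_d ⊂ K_d^ab (Abelian over K_d)
  ((∀ γ ∈ ΓH', D.galPt γ z = z) ∧
    (∀ s t : D.H ≃ₐ[ℚ] D.H, s (D.sqrtNeg d) = D.sqrtNeg d → t (D.sqrtNeg d) = D.sqrtNeg d →
      s⁻¹ * t⁻¹ * s * t ∈ ΓH')) ∧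
  -- (G4) "H′_n = H_n(z_n)" (H_d ⊂ H′_d); "the genus field L_n is the subfield of H_n fixed by 2Cl_n" (L_d ⊂ H_d)
  ((∀ γ ∈ ΓH', γ ∈ ΓH) ∧ (∀ γ ∈ ΓH, γ ∈ C.ΓL d)) ∧
  -- (G5) Thm 3.6 (1) "z̄_n = −z_n + τ(1)" / (2) "z̄_n = −z_n"
  ((d % 8 = 5 → D.galPt c z = -z + tauOne) ∧ (d % 8 = 6 → D.galPt c z = -z)) ∧
  -- (G6) "σ the unique order-two element of Gal(H′_n/H_n)" — σ ∈ Gal(ℍ′_n/H_d) displayed for d ≡ 5 only;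
  --      "Thus z_n^{σ_ϖ²} = z_n + τ(1)" / "Thus z_n^{σ²_{1+ϖ}} = z_n + τ(1)"
  ((d % 8 = 5 → σ ∈ ΓH) ∧ σ * σ ∈ ΓH' ∧ D.galPt σ z = z + tauOne) ∧
  -- (G7) "Φ₀ is a set of representatives of 2Cl_n = (2Cl′_n)/⟨σ⟩ in 2Cl′_n"; "α acts trivially on L_n(i) ⟹ α ∈ 2Cl′_n"
  ((∀ g : D.H ≃ₐ[ℚ] D.H, D.TrivialOnL d g → ∃ t ∈ Φ, g * t⁻¹ ∈ ΓH' ∨ g * (t * σ)⁻¹ ∈ ΓH') ∧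
    (∀ t₁ ∈ Φ, ∀ t₂ ∈ Φ, (t₁ * t₂⁻¹ ∈ ΓH' ∨ t₁ * (t₂ * σ)⁻¹ ∈ ΓH') → t₁ = t₂)) ∧
  -- (R) Prop 3.2 (1) "H′_n(√2) is the ring class field of conductor 4 over K_n … H′_n is the subfield of H′_n(√2) fixed by σ_{1+2ϖ}"
  --     Prop 3.2 (2) "The field H′_n is exactly the ring class field of conductor 4 over K_n"
  C.InRingClassField d ΓH'

/-- `CMBlockClassFieldSpec ⟹ CMBlockClassFieldSpecReduced` (weaken (G6)'s first conjunct). [cite: TianYuanZhang2017, §3.1 (J738)] -/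
theorem cmBlockClassFieldSpecReduced_of_spec {D : GenusPointData n} (C : D.ClassFieldData) {d : ℕ}
    {z : APoint D.H} {Φ : Finset (D.H ≃ₐ[ℚ] D.H)} {ΓH ΓH' : Subgroup (D.H ≃ₐ[ℚ] D.H)} {σ c : D.H ≃ₐ[ℚ] D.H}
    (h : C.CMBlockClassFieldSpec d z Φ ΓH ΓH' σ c) : C.CMBlockClassFieldSpecReduced d z Φ ΓH ΓH' σ c := by
  obtain ⟨hG1, hG2, hG3, hG4, hG5, ⟨hσH, hσσ, hσz⟩, hG7, hR⟩ := h
  exact ⟨hG1, hG2, hG3, hG4, hG5, ⟨fun _ => hσH, hσσ, hσz⟩, hG7, hR⟩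

/-- **«`σ ∈ Gal(H′_d/H_d)`» for `d ≡ 6 (mod 8)` is a kernel theorem**: from (G8) `θ ∈ Gal(ℍ′_n/H_d)`, `θ²σ⁻¹ ∈ Gal(ℍ′_n/H′_d)`
and (G4a) `Gal(ℍ′_n/H′_d) ≤ Gal(ℍ′_n/H_d)`, `σ = (θ²σ⁻¹)⁻¹·θ² ∈ Gal(ℍ′_n/H_d)`; for `d ≡ 5` the sentence is displayed.
[cite: TianYuanZhang2017, §3.1 (J738 = p0011 L3) and Prop. 3.2 (2) (J738 = p0010 L111)] -/
theorem cmBlockClassFieldSpec_of_reduced {D : GenusPointData n} (C : D.ClassFieldData) {d : ℕ}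
    (hd56 : d % 8 = 5 ∨ d % 8 = 6) {z : APoint D.H} {Φ : Finset (D.H ≃ₐ[ℚ] D.H)}
    {ΓH ΓH' : Subgroup (D.H ≃ₐ[ℚ] D.H)} {σ θ c : D.H ≃ₐ[ℚ] D.H}
    (hθ : d % 8 = 6 → D.ThetaBlockSpecReduced z ΓH ΓH' σ θ)
    (h : C.CMBlockClassFieldSpecReduced d z Φ ΓH ΓH' σ c) : C.CMBlockClassFieldSpec d z Φ ΓH ΓH' σ c := by
  obtain ⟨hG1, hG2, hG3, ⟨hG4a, hG4b⟩, hG5, ⟨hσH5, hσσ, hσz⟩, hG7, hR⟩ := h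
  refine ⟨hG1, hG2, hG3, ⟨hG4a, hG4b⟩, hG5, ⟨?_, hσσ, hσz⟩, hG7, hR⟩
  rcases hd56 with h5 | h6
  · exact hσH5 h5
  · obtain ⟨-, hθH, hθθσ⟩ := hθ h6
    have hσ : σ = (θ * θ * σ⁻¹)⁻¹ * (θ * θ) := by group
    rw [hσ]
    exact ΓH.mul_mem (ΓH.inv_mem (hG4a _ hθθσ)) (ΓH.mul_mem hθH hθH)

end ClassFieldData

/-- **`CMPointClassFieldPrinted` with the two block sentences struck**: the same objects and the same displays
(`ConjSpec`, `CoxDisplays`, `SevenBlockClassFieldSpec`), with `CMBlockClassFieldSpecReduced` and `ThetaBlockSpecReduced`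
in place of `CMBlockClassFieldSpec` and `ThetaBlockSpec`. A predicate; nothing asserted.
[cite: TianYuanZhang2017, §3.1 (J738–J739), Prop. 3.2 (1)(2)(3), Thm. 3.6 (1)(2) (J741), proof of Lemma 3.21 (J759), §2.1 (J725)]
[cite: Cox2013, Theorem 6.1 (ii) and Theorem 9.18] -/
def CMPointClassFieldPrintedReduced (D : GenusPointData n) : Prop :=
  ∃ (C : D.ClassFieldData) (z : ℕ → APoint D.H) (Φ : ℕ → Finset (D.H ≃ₐ[ℚ] D.H))
    (ΓH ΓH' : ℕ → Subgroup (D.H ≃ₐ[ℚ] D.H)) (σ θ : ℕ → (D.H ≃ₐ[ℚ] D.H)) (c : D.H ≃ₐ[ℚ] D.H),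
    D.ConjSpec c ∧ C.CoxDisplays c ∧
    ∀ d ∈ n.divisors,
      ((d % 8 = 5 ∨ d % 8 = 6) → C.CMBlockClassFieldSpecReduced d (z d) (Φ d) (ΓH d) (ΓH' d) (σ d) c) ∧
      (d % 8 = 6 → D.ThetaBlockSpecReduced (z d) (ΓH d) (ΓH' d) (σ d) (θ d)) ∧
      (d % 8 = 7 → C.SevenBlockClassFieldSpec d)

/-- `CMPointClassFieldPrinted ⟹ CMPointClassFieldPrintedReduced` (drop the two conjuncts). [cite: TianYuanZhang2017, §3.1, Prop. 3.2] -/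
theorem cmPointClassFieldPrintedReduced_of_printed (D : GenusPointData n) (h : D.CMPointClassFieldPrinted) :
    D.CMPointClassFieldPrintedReduced := by
  obtain ⟨C, z, Φ, ΓH, ΓH', σ, θ, c, hc, hCox, hblk⟩ := h
  refine ⟨C, z, Φ, ΓH, ΓH', σ, θ, c, hc, hCox, fun d hd => ?_⟩
  obtain ⟨h56, h6, h7⟩ := hblk d hd
  exact ⟨fun hd56 => C.cmBlockClassFieldSpecReduced_of_spec (h56 hd56),
    fun hd6 => D.thetaBlockSpecReduced_of_spec (h6 hd6), h7⟩

/-- `CMPointClassFieldPrintedReduced ⟹ CMPointClassFieldPrinted` (the two struck sentences are kernel theorems of the rest).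
[cite: TianYuanZhang2017, §3.1 (J738 = p0011 L3), Prop. 3.2 (2) (J738 = p0010 L111), proof of Lemma 3.21 (J759 L25)]
[cite: Cox2013, Theorem 6.1 (ii)] -/
theorem cmPointClassFieldPrinted_of_reduced (D : GenusPointData n) (h : D.CMPointClassFieldPrintedReduced) :
    D.CMPointClassFieldPrinted := by
  obtain ⟨C, z, Φ, ΓH, ΓH', σ, θ, c, hc, hCox, hblk⟩ := h
  refine ⟨C, z, Φ, ΓH, ΓH', σ, θ, c, hc, hCox, fun d hd => ?_⟩
  obtain ⟨h56, h6, h7⟩ := hblk d hd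
  refine ⟨fun hd56 => C.cmBlockClassFieldSpec_of_reduced hd56 h6 (h56 hd56), fun hd6 => ?_, h7⟩
  exact C.thetaBlockSpec_of_reduced hd hCox.1 hCox.2.1 (h56 (Or.inr hd6)).2.2.2.1.2 (h6 hd6)

/-- **`CMPointClassFieldPrinted ⟺ CMPointClassFieldPrintedReduced`.** [cite: TianYuanZhang2017, §3.1, Prop. 3.2] [cite: Cox2013, Theorem 6.1 (ii)] -/
theorem cmPointClassFieldPrinted_iff_reduced (D : GenusPointData n) :
    D.CMPointClassFieldPrinted ↔ D.CMPointClassFieldPrintedReduced :=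
  ⟨D.cmPointClassFieldPrintedReduced_of_printed, D.cmPointClassFieldPrinted_of_reduced⟩

end GenusPointData

/-! ## §4 The ONE named fact, and its equivalence with `tyz_cmPointClassFieldData` -/

/-- **Tian–Yuan–Zhang 2017, §3 with the CM-point layer and its class fields AS PRINTED, REDUCED, as ONE named fact**: for
every positive square-free `n ≡ 5, 6, 7 (mod 8)` there are data `D : GenusPointData n` satisfying `PrintedCore` (Prop. 3.4,
Thm. 3.5's main clause, first bullet and «i.e.», Lemma 3.18, the `β′`-facts, Lemma 3.21 — Thm. 3.5's second bullet struck)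
and `CMPointClassFieldPrintedReduced` (the layer of `tyz_cmPointClassFieldData` with «`σ_{1+ϖ}` fixes `√−d`» and, for
`d ≡ 6`, «`σ ∈ Gal(H′_d/H_d)`» struck).  EQUIVALENT in the kernel to `tyz_cmPointClassFieldData`
(`tyz_cmPointClassFieldData_iff_reduced`); constructed in the source from the CM points on `X_U → A`, Yuan–Zhang–Zhang's
Gross–Zagier formula and class field theory; no `_holds` expected; consumers take it as an explicit hypothesis; nothing is
asserted here.
[cite: TianYuanZhang2017, §3: §3.1 (J738–J739), Prop. 3.2, Prop. 3.4, Thm. 3.5, Thm. 3.6 (J741), Lemma 3.18, Lemma 3.21 and its proof (J759), §2.1 (J725)]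
[cite: Cox2013, Theorem 6.1 (ii), Theorem 9.18, Lemma 9.3, (5.12)] -/
def tyz_cmPointClassFieldDataReduced : Prop :=
  ∀ (n : ℕ), Squarefree n → (n % 8 = 5 ∨ n % 8 = 6 ∨ n % 8 = 7) →
    ∃ D : GenusPointData n, D.PrintedCore ∧ D.CMPointClassFieldPrintedReduced

/-- `tyz_cmPointClassFieldDataReduced ⟹ tyz_cmPointClassFieldData` (the three struck sentences are kernel theorems).
[cite: TianYuanZhang2017, §3] [cite: Cox2013, Theorem 6.1 (ii)] -/
theorem tyz_cmPointClassFieldData_of_reduced (h : tyz_cmPointClassFieldDataReduced) : tyz_cmPointClassFieldData := by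
  intro n hn h8
  obtain ⟨D, hD, hC⟩ := h n hn h8
  exact ⟨D, D.printed_of_printedCore hn h8 hD, D.cmPointClassFieldPrinted_of_reduced hC⟩

/-- `tyz_cmPointClassFieldData ⟹ tyz_cmPointClassFieldDataReduced` (drop the three conjuncts). [cite: TianYuanZhang2017, §3] -/
theorem tyz_cmPointClassFieldDataReduced_of_data (h : tyz_cmPointClassFieldData) :
    tyz_cmPointClassFieldDataReduced := by
  intro n hn h8
  obtain ⟨D, hD, hC⟩ := h n hn h8
  exact ⟨D, D.printedCore_of_printed hD, D.cmPointClassFieldPrintedReduced_of_printed hC⟩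

/-- **`tyz_cmPointClassFieldData ⟺ tyz_cmPointClassFieldDataReduced`** in the kernel. [cite: TianYuanZhang2017, §3]
[cite: Cox2013, Theorem 6.1 (ii)] -/
theorem tyz_cmPointClassFieldData_iff_reduced : tyz_cmPointClassFieldData ↔ tyz_cmPointClassFieldDataReduced :=
  ⟨tyz_cmPointClassFieldDataReduced_of_data, tyz_cmPointClassFieldData_of_reduced⟩

/-- `tyz_cmPointClassFieldDataReduced` implies `tyz_cmPointGaloisData` and hence `tyz_genusPointData`.
[cite: TianYuanZhang2017, §3] [cite: Cox2013, Theorem 6.1 (ii) and Theorem 9.18] -/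
theorem tyz_cmPointGaloisData_of_cmPointClassFieldDataReduced (h : tyz_cmPointClassFieldDataReduced) :
    tyz_cmPointGaloisData :=
  tyz_cmPointGaloisData_of_cmPointClassFieldData (tyz_cmPointClassFieldData_of_reduced h)

end Literature.NumberTheory.EllipticCurves.TianYuanZhang2017

end
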